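import Summits.QuantumFields.QCD.Theses.PauliWegnerSea
import Literature.MathematicalPhysics.QuantumFieldTheory.QCDCurrentSector
import Literature.MathematicalPhysics.QuantumFieldTheory.QCDTimeReflection
import Summits.QuantumFields.QCD.Theorems.SpectralDefectExtinctionWindowExtinctionChessboardTransferFragments

/-!
# The chord inequality for locally log-convex non-negative sequences (crux `PauliWegnerSea.ChiralOneScaleTrajectory`, stmt-QuantumFields-17512, line `log-convex-continuum-lift`,
registered stub `stub_chord` of skeleton v2 `Cruxes/ChiralOneScaleTrajectory/Lines/log_convex_continuum_lift.lean`)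

We prove the registered stub `stub_chord : CHORD`, a statement of elementary real analysis:
if `e : ℕ → ℝ` is non-negative on `1 ≤ j ≤ N` and *locally log-convex* at the interior indices,
`e j ^ 2 ≤ e (j - 1) * e (j + 1)` for `2 ≤ j`, `j + 1 ≤ N`, then for all `1 ≤ i < j < k ≤ N` the
three-point **chord inequality** `e j ^ (k - i) ≤ e i ^ (k - j) * e k ^ (j - i)` holds (all exponents
in `ℕ`; the subtractions are harmless because `i < j < k`).

Proof.  If `e j = 0` the left-hand side is `0 ^ (k - i) = 0` (`k - i ≥ 2`) and the right-hand side is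
non-negative.  If `e j > 0`, the local inequality at `j` forces `e (j-1) * e (j+1) > 0`, hence both factors
are positive, and iterating outwards every `e l` with `i ≤ l ≤ k` is positive (all the local inequalities
used have `2 ≤ l` and `l + 1 ≤ N` because `1 ≤ i < l < k ≤ N`).  On this positive stretch
`a l := Real.log (e l)` is midpoint-convex, `2 a_l ≤ a_{l-1} + a_{l+1}` (`i < l < k`), and the additive
chord inequality `(k - i) a_j ≤ (k - j) a_i + (j - i) a_k` (`chord_of_midpoint_convex`, induction on `k`)
exponentiates to the claim via `Real.log_pow`, `Real.log_mul`, `Real.log_le_log_iff`.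

Sources: folklore (discrete convexity; e.g. Hardy–Littlewood–Pólya, *Inequalities*, §3.5–3.6 on convex
sequences).  Nothing about QCD is used; the NOTATION PRELUDE of the line is pasted only so that the
registered notation `CHORD` is literally the skeleton's.
-/

noncomputable section

namespace Summit.QuantumFields.QCD.Cruxes.ChiralOneScaleTrajectory.LogConvexLift.Chord

open scoped BigOperators Topology ComplexOrder
open MeasureTheory Filter
open Literature.MathematicalPhysics.QuantumFieldTheory Literature.MathematicalPhysics.QuantumLattice
  Literature.Probability.LatticeModels

/-! ### NOTATION PRELUDE (paste verbatim into every stub work file; expands to tree declarations only)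

* `nAP⟪β, S, mq, f, g, v⟫` — UN-normalised antiperiodic flavoured pion numerator on the torus of side `2S+1`:
  `∫dμ_W(β) ∫dψ̄dψ (ψ̄_g γ₅ ψ_f)(0) · (ψ̄_f γ₅ ψ_g)(v) · e^{−ψ̄ D_AP(U) ψ}` (`v : Site 4`, read mod `2S+1`);
* `nP⟪…⟫` — the same with the Statement's time-PERIODIC `fermiBoltzmann`;
* `zAP⟪β, S, mq⟫`, `zP⟪β, S, mq⟫` — the two partition functions;
* `dAP⟪β, S, mq, f, g, T, h, n⟫` — the source-and-sink smeared trace `𝒟_h(n) = Σ_{z,z' ∈ T} h z h z' N_AP(n e₀ + z' − z)`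
  for a real profile `h` on the finite set `T` of (spatial) sites;
* `APTI⟪Nf⟫`, `TP⟪Nf⟫`, `CHORD`, `LOGROOM⟪reg⟫`, `TWIST⟪Nf, reg⟫`, `LIGHT⟪Nf, reg⟫` — the Props of the stubs. -/

local notation "SU3" => Matrix.specialUnitaryGroup (Fin 3) ℂ

local notation "nAP⟪" β ", " S ", " mq ", " f ", " g ", " v "⟫" =>
  (∫ U : GaugeConfig 4 (2 * S + 1) (Matrix.specialUnitaryGroup (Fin 3) ℂ),
      fermiIntegral (torusBilinear g f (Torus.proj (2 * S + 1) 0) (Torus.proj (2 * S + 1) 0) gammaFive 1 *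
          torusBilinear f g (Torus.proj (2 * S + 1) v) (Torus.proj (2 * S + 1) v) gammaFive 1 *
        fermiBoltzmannAP U mq)
    ∂(wilsonMeasure (fundamentalRep (Fin 3)) β))

local notation "nP⟪" β ", " S ", " mq ", " f ", " g ", " v "⟫" =>
  (∫ U : GaugeConfig 4 (2 * S + 1) (Matrix.specialUnitaryGroup (Fin 3) ℂ),
      fermiIntegral (torusBilinear g f (Torus.proj (2 * S + 1) 0) (Torus.proj (2 * S + 1) 0) gammaFive 1 *
          torusBilinear f g (Torus.proj (2 * S + 1) v) (Torus.proj (2 * S + 1) v) gammaFive 1 *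
        fermiBoltzmann U mq)
    ∂(wilsonMeasure (fundamentalRep (Fin 3)) β))

local notation "zAP⟪" β ", " S ", " mq "⟫" =>
  (∫ U : GaugeConfig 4 (2 * S + 1) (Matrix.specialUnitaryGroup (Fin 3) ℂ),
      fermiIntegral (fermiBoltzmannAP U mq) ∂(wilsonMeasure (fundamentalRep (Fin 3)) β))

local notation "zP⟪" β ", " S ", " mq "⟫" =>
  (∫ U : GaugeConfig 4 (2 * S + 1) (Matrix.specialUnitaryGroup (Fin 3) ℂ),
      fermiIntegral (fermiBoltzmann U mq) ∂(wilsonMeasure (fundamentalRep (Fin 3)) β))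

local notation "dAP⟪" β ", " S ", " mq ", " f ", " g ", " T ", " h ", " n "⟫" =>
  (∑ z ∈ (T : Finset (Literature.Probability.LatticeModels.Site 4)),
    ∑ z' ∈ (T : Finset (Literature.Probability.LatticeModels.Site 4)),
      (((h : Literature.Probability.LatticeModels.Site 4 → ℝ) z * h z' : ℝ) : ℂ) *
        nAP⟪β, S, mq, f, g, (Pi.single (0 : Fin 4) (((n : ℕ) : ℤ)) + (z' - z))⟫)

-- `APTI⟪Nf⟫`: translation invariance of the un-normalised antiperiodic two-bilinear functional.
set_option quotPrecheck false in
local notation "APTI⟪" Nf "⟫" =>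
  (∀ (β : ℝ) (S : ℕ) (mq : Fin Nf → ℝ) (f g f' g' : Fin Nf) (Γ Γ' : Matrix (Fin 4) (Fin 4) ℂ)
      (x y u : TorusSite 4 (2 * S + 1)),
    (∫ U : GaugeConfig 4 (2 * S + 1) (Matrix.specialUnitaryGroup (Fin 3) ℂ),
        fermiIntegral (torusBilinear f g x x Γ 1 * torusBilinear f' g' y y Γ' 1 * fermiBoltzmannAP U mq)
      ∂(wilsonMeasure (fundamentalRep (Fin 3)) β)) =
    ∫ U : GaugeConfig 4 (2 * S + 1) (Matrix.specialUnitaryGroup (Fin 3) ℂ),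
        fermiIntegral (torusBilinear f g (x + u) (x + u) Γ 1 * torusBilinear f' g' (y + u) (y + u) Γ' 1 *
          fermiBoltzmannAP U mq)
      ∂(wilsonMeasure (fundamentalRep (Fin 3)) β))

-- `TP⟪Nf⟫`: the RP–Hankel form of transfer positivity (even separations, phase `u`).
set_option quotPrecheck false in
local notation "TP⟪" Nf "⟫" =>
  (∀ (β : ℝ), 0 ≤ β → ∀ (S : ℕ), 1 ≤ S → ∀ (mq : Fin Nf → ℝ), (∀ fl, -1 < mq fl) → ∀ (f g : Fin Nf),
    ∃ u : ℂ, ‖u‖ = 1 ∧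
      (∀ (T : Finset (Literature.Probability.LatticeModels.Site 4)) (h : Literature.Probability.LatticeModels.Site 4 → ℝ),
        (∀ z ∈ T, z 0 = 0 ∧ ∀ i, |z i| ≤ (S : ℤ)) →
        ∀ (s t : ℕ), 1 ≤ s → s ≤ S → 1 ≤ t → t ≤ S →
          0 ≤ u * dAP⟪β, S, mq, f, g, T, h, 2 * s⟫ ∧
          ‖dAP⟪β, S, mq, f, g, T, h, s + t⟫‖ ^ 2 ≤
            (u * dAP⟪β, S, mq, f, g, T, h, 2 * s⟫).re * (u * dAP⟪β, S, mq, f, g, T, h, 2 * t⟫).re) ∧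
      (∀ (t : ℕ) (w : Literature.Probability.LatticeModels.Site 4), 1 ≤ t → t ≤ S → w 0 = 0 →
        (∀ i, |w i| ≤ (S : ℤ)) →
          ‖nAP⟪β, S, mq, f, g, (Pi.single (0 : Fin 4) (((2 * t : ℕ) : ℤ)) + w)⟫‖ ≤
            (u * nAP⟪β, S, mq, f, g, (Pi.single (0 : Fin 4) (((2 * t : ℕ) : ℤ)))⟫).re))

-- `CHORD`: local log-convexity of a non-negative finite sequence gives the three-point chord inequality.
set_option quotPrecheck false in
local notation "CHORD" =>
  (∀ (e : ℕ → ℝ) (N : ℕ), (∀ j, 1 ≤ j → j ≤ N → 0 ≤ e j) →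
    (∀ j, 2 ≤ j → j + 1 ≤ N → e j ^ 2 ≤ e (j - 1) * e (j + 1)) →
    ∀ i j k : ℕ, 1 ≤ i → i < j → j < k → k ≤ N → e j ^ (k - i) ≤ e i ^ (k - j) * e k ^ (j - i))

-- `LOGROOM⟪reg⟫`: superlogarithmic physical volume.
set_option quotPrecheck false in
local notation "LOGROOM⟪" reg "⟫" =>
  (Tendsto (fun k => QCDRegularisation.a reg k * (QCDRegularisation.L reg k : ℝ) /
    (1 + |Real.log (QCDRegularisation.a reg k)|)) atTop atTop)

-- `TWIST⟪Nf, reg⟫`: the `(−1)^F` twist is invisible at log-scale separations, at `S = L_k`, eventually.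
set_option quotPrecheck false in
local notation "TWIST⟪" Nf ", " reg "⟫" =>
  (∀ (m : Fin Nf → ℝ), (∀ fl, 0 < m fl) → ∀ (f g : Fin Nf), f ≠ g → ∀ K : ℝ, ∀ᶠ k in atTop,
    2 * ‖zAP⟪QCDRegularisation.β reg k, QCDRegularisation.L reg k,
            fun fl => QCDRegularisation.mcrit reg k + QCDRegularisation.a reg k * m fl / QCDRegularisation.Zm reg k⟫ -
          zP⟪QCDRegularisation.β reg k, QCDRegularisation.L reg k,
            fun fl => QCDRegularisation.mcrit reg k + QCDRegularisation.a reg k * m fl / QCDRegularisation.Zm reg k⟫‖ ≤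
      ‖zAP⟪QCDRegularisation.β reg k, QCDRegularisation.L reg k,
          fun fl => QCDRegularisation.mcrit reg k + QCDRegularisation.a reg k * m fl / QCDRegularisation.Zm reg k⟫‖ ∧
    ∀ n : ℕ, (n : ℝ) * QCDRegularisation.a reg k ≤ K * (1 + |Real.log (QCDRegularisation.a reg k)|) →
      2 * ‖nAP⟪QCDRegularisation.β reg k, QCDRegularisation.L reg k,
              fun fl => QCDRegularisation.mcrit reg k + QCDRegularisation.a reg k * m fl / QCDRegularisation.Zm reg k,
              f, g, (Pi.single (0 : Fin 4) ((n : ℕ) : ℤ))⟫ -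
            nP⟪QCDRegularisation.β reg k, QCDRegularisation.L reg k,
              fun fl => QCDRegularisation.mcrit reg k + QCDRegularisation.a reg k * m fl / QCDRegularisation.Zm reg k,
              f, g, (Pi.single (0 : Fin 4) ((n : ℕ) : ℤ))⟫‖ ≤
        ‖nAP⟪QCDRegularisation.β reg k, QCDRegularisation.L reg k,
            fun fl => QCDRegularisation.mcrit reg k + QCDRegularisation.a reg k * m fl / QCDRegularisation.Zm reg k,
            f, g, (Pi.single (0 : Fin 4) ((n : ℕ) : ℤ))⟫‖)

-- `LIGHT⟪Nf, reg⟫`: LatticeLightness at EVEN lattice times `2n₁ < 2n₂` within a fixed physical distance, with a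
-- polynomial floor relative to `‖Z_AP‖ > 0`, frequently in `k`, at `S = L_k`.
set_option quotPrecheck false in
local notation "LIGHT⟪" Nf ", " reg "⟫" =>
  (∀ ε : ℝ, 0 < ε → ∃ m : Fin Nf → ℝ, (∀ fl, 0 < m fl) ∧ ∃ (f g : Fin Nf), f ≠ g ∧
    ∃ (R : ℝ) (p : ℕ) (C : ℝ), 0 < C ∧ ∃ᶠ k in atTop,
      ∃ (T : Finset (Literature.Probability.LatticeModels.Site 4)) (h : Literature.Probability.LatticeModels.Site 4 → ℝ)
        (n₁ n₂ : ℕ),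
        1 ≤ n₁ ∧ n₁ < n₂ ∧ (n₂ : ℝ) * QCDRegularisation.a reg k ≤ R ∧
        (∀ z ∈ T, z 0 = 0 ∧ ∀ i, |z i| ≤ (n₂ : ℤ)) ∧
        0 < ∑ z ∈ T, |h z| ∧
        0 < ‖zAP⟪QCDRegularisation.β reg k, QCDRegularisation.L reg k,
              fun fl => QCDRegularisation.mcrit reg k + QCDRegularisation.a reg k * m fl / QCDRegularisation.Zm reg k⟫‖ ∧
        C * QCDRegularisation.a reg k ^ p * ((∑ z ∈ T, |h z|) ^ 2 *
            ‖zAP⟪QCDRegularisation.β reg k, QCDRegularisation.L reg k,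
              fun fl => QCDRegularisation.mcrit reg k + QCDRegularisation.a reg k * m fl / QCDRegularisation.Zm reg k⟫‖) ≤
          ‖dAP⟪QCDRegularisation.β reg k, QCDRegularisation.L reg k,
              fun fl => QCDRegularisation.mcrit reg k + QCDRegularisation.a reg k * m fl / QCDRegularisation.Zm reg k,
              f, g, T, h, 2 * n₂⟫‖ ∧
        ‖dAP⟪QCDRegularisation.β reg k, QCDRegularisation.L reg k,
            fun fl => QCDRegularisation.mcrit reg k + QCDRegularisation.a reg k * m fl / QCDRegularisation.Zm reg k,
            f, g, T, h, 2 * n₁⟫‖ ≤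
          ‖dAP⟪QCDRegularisation.β reg k, QCDRegularisation.L reg k,
              fun fl => QCDRegularisation.mcrit reg k + QCDRegularisation.a reg k * m fl / QCDRegularisation.Zm reg k,
              f, g, T, h, 2 * n₂⟫‖ * Real.exp (ε * (QCDRegularisation.a reg k * ((n₂ : ℝ) - n₁))))


/-! ### (end of NOTATION PRELUDE — statements below must use these notations verbatim) -/

/-! ### The discrete chord inequality, additive form -/

/-- **Discrete chord inequality for midpoint-convex sequences (additive form).**  If `a : ℕ → ℝ` satisfies
`2 a_l ≤ a_{l-1} + a_{l+1}` at every integer `l` strictly between `i` and `k`, then for every `i ≤ j ≤ k`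
the point `(j, a_j)` lies below the chord from `(i, a_i)` to `(k, a_k)`:
`(k - i) a_j ≤ (k - j) a_i + (j - i) a_k` (casts to `ℝ`, no `ℕ`-subtraction).  Induction on `k`: the new
endpoint inequality `(k + 1 - i) a_k ≤ a_i + (k - i) a_{k+1}` is the inductive chord at `j = k - 1` plus
`(k - i)` times the midpoint inequality at `k`, and the general `j ≤ k` is a positive combination of it
with the inductive chord at `j`. [folklore] -/
theorem chord_of_midpoint_convex (a : ℕ → ℝ) (i : ℕ) :
    ∀ k : ℕ, (∀ l : ℕ, i < l → l < k → 2 * a l ≤ a (l - 1) + a (l + 1)) →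
      ∀ j : ℕ, i ≤ j → j ≤ k → ((k : ℝ) - i) * a j ≤ ((k : ℝ) - j) * a i + ((j : ℝ) - i) * a k := by
  intro k
  induction k with
  | zero =>
    intro _ j hij hj0
    obtain rfl : j = 0 := Nat.le_zero.mp hj0
    obtain rfl : i = 0 := Nat.le_zero.mp hij
    simp
  | succ k ih =>
    intro hloc j hij hjk
    rcases Nat.lt_or_ge k j with hkj | hkj
    · -- `j = k + 1`: both sides agree
      obtain rfl : j = k + 1 := le_antisymm hjk hkj
      exact le_of_eq (by ring)
    · have ih' := ih fun l h1 h2 => hloc l h1 (Nat.lt_succ_of_lt h2)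
      have hj := ih' j hij hkj
      rcases (le_trans hij hkj).eq_or_lt with hik | hik
      · -- `i = k`: then `j = i` and both sides agree
        have hji : j = i := by omega
        subst hji
        subst hik
        exact le_of_eq (by ring)
      · -- `i < k`: the midpoint inequality at `k` is available
        have hl := hloc k hik (Nat.lt_succ_self k)
        have hkm1 := ih' (k - 1) (by omega) (by omega)
        have hcast : ((k - 1 : ℕ) : ℝ) = (k : ℝ) - 1 := by
          rw [Nat.cast_sub (by omega), Nat.cast_one]
        rw [hcast] at hkm1
        have hki : (0 : ℝ) < (k : ℝ) - i := sub_pos.mpr (by exact_mod_cast hik)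
        -- the new endpoint inequality
        have hN : ((k : ℝ) + 1 - i) * a k ≤ a i + ((k : ℝ) - i) * a (k + 1) := by
          linarith [mul_le_mul_of_nonneg_left hl hki.le]
        have hji : (0 : ℝ) ≤ (j : ℝ) - i := sub_nonneg.mpr (by exact_mod_cast hij)
        have hk1i : (0 : ℝ) ≤ (k : ℝ) + 1 - i := by linarith
        refine le_of_mul_le_mul_left ?_ hki
        push_cast
        linarith [mul_le_mul_of_nonneg_left hj hk1i, mul_le_mul_of_nonneg_left hN hji]

/-! ### The registered stub -/

/-- **Stub 3 · the chord inequality** for locally log-convex non-negative finite sequences (zeros propagate):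
if `0 ≤ e j` on `1 ≤ j ≤ N` and `e j ^ 2 ≤ e (j-1) * e (j+1)` for `2 ≤ j`, `j + 1 ≤ N`, then
`e j ^ (k - i) ≤ e i ^ (k - j) * e k ^ (j - i)` whenever `1 ≤ i < j < k ≤ N`.  If `e j = 0` the left side
vanishes; otherwise positivity spreads from `j` to the whole stretch `[i, k]` through the local inequalities,
`Real.log ∘ e` is midpoint-convex there, and `chord_of_midpoint_convex` exponentiates to the claim. [folklore] -/
theorem stub_chord : CHORD := by
  intro e N hnn hlc i j k hi hij hjk hkN
  rcases (hnn j (by omega) (by omega)).eq_or_lt with hj0 | hjpos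
  · -- `e j = 0`: the left-hand side vanishes
    rw [← hj0, zero_pow (by omega)]
    exact mul_nonneg (pow_nonneg (hnn i hi (by omega)) _) (pow_nonneg (hnn k (by omega) hkN) _)
  · -- `e j > 0`: positivity spreads upwards ...
    have hup : ∀ m : ℕ, j + m ≤ k → 0 < e (j + m) := by
      intro m
      induction m with
      | zero => intro; simpa using hjpos
      | succ m ihm =>
        intro hm
        have hprev := ihm (by omega)
        have hloc := hlc (j + m) (by omega) (by omega)
        have hsq : 0 < e (j + m - 1) * e (j + m + 1) := lt_of_lt_of_le (pow_pos hprev 2) hloc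
        exact pos_of_mul_pos_right hsq (hnn _ (by omega) (by omega))
    -- ... and downwards
    have hdown : ∀ m : ℕ, i + m ≤ j → 0 < e (j - m) := by
      intro m
      induction m with
      | zero => intro; simpa using hjpos
      | succ m ihm =>
        intro hm
        have hprev := ihm (by omega)
        have hloc := hlc (j - m) (by omega) (by omega)
        have hsq : 0 < e (j - m - 1) * e (j - m + 1) := lt_of_lt_of_le (pow_pos hprev 2) hloc
        have h := pos_of_mul_pos_left hsq (hnn _ (by omega) (by omega))
        rwa [show j - (m + 1) = j - m - 1 from by omega]
    have hpos : ∀ l : ℕ, i ≤ l → l ≤ k → 0 < e l := by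
      intro l h1 h2
      rcases le_or_gt l j with h | h
      · have h' := hdown (j - l) (by omega)
        rwa [show j - (j - l) = l from by omega] at h'
      · have h' := hup (l - j) (by omega)
        rwa [show j + (l - j) = l from by omega] at h'
    -- midpoint convexity of the logarithms on the positive stretch
    have hcvx : ∀ l : ℕ, i < l → l < k →
        2 * Real.log (e l) ≤ Real.log (e (l - 1)) + Real.log (e (l + 1)) := by
      intro l h1 h2
      have hloc := hlc l (by omega) (by omega)
      have hlog := Real.log_le_log (pow_pos (hpos l h1.le h2.le) 2) hloc
      rwa [Real.log_pow, Real.log_mul (hpos (l - 1) (by omega) (by omega)).ne'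
        (hpos (l + 1) (by omega) (by omega)).ne', Nat.cast_ofNat] at hlog
    have hadd : ((k : ℝ) - i) * Real.log (e j) ≤
        ((k : ℝ) - j) * Real.log (e i) + ((j : ℝ) - i) * Real.log (e k) :=
      chord_of_midpoint_convex (fun l => Real.log (e l)) i k hcvx j hij.le hjk.le
    -- exponentiate
    have hipos := pow_pos (hpos i le_rfl (by omega)) (k - j)
    have hkpos := pow_pos (hpos k (by omega) le_rfl) (j - i)
    refine (Real.log_le_log_iff (pow_pos hjpos _) (mul_pos hipos hkpos)).1 ?_
    rw [Real.log_mul hipos.ne' hkpos.ne', Real.log_pow, Real.log_pow, Real.log_pow,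
      Nat.cast_sub (show i ≤ k by omega), Nat.cast_sub (show j ≤ k by omega),
      Nat.cast_sub (show i ≤ j by omega)]
    exact hadd

end Summit.QuantumFields.QCD.Cruxes.ChiralOneScaleTrajectory.LogConvexLift.Chord

end
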